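import Summits.FinalStateConjecture.FinalStateConjecture.Theorems.PhotonSphereChannelsExteriorEnergyRW
import Summits.FinalStateConjecture.FinalStateConjecture.Theorems.PhotonSphereChannelsChannelsResolveTameDevelopmentsRTotalEnergyConservation
import Summits.FinalStateConjecture.FinalStateConjecture.Theorems.PhotonSphereChannelsWindowedShellChannelsStubOutVirial
import Summits.FinalStateConjecture.FinalStateConjecture.Theorems.PhotonSphereChannelsWindowedShellChannelsStubConeInflux
import Summits.FinalStateConjecture.FinalStateConjecture.Theorems.PhotonSphereChannelsWindowedShellChannelsStubLostFlux
import Summits.FinalStateConjecture.FinalStateConjecture.Theorems.PhotonSphereChannelsWindowedShellChannelsStubPeakShape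

/-!
# Crux `WindowedShellChannels` (stmt-FinalStateConjecture-14085), line `Sketch`: the peak-cross bookkeeping (★) as a theorem

Support file for the crux (lead c2; glue first written by lead c1 in `Lines/Sketch.lean`).  Centred unit-mass tortoise line, `V = V_{s,ℓ}`,
`xp` its peak (`stub_peakShape`), finite-energy parity-pure `ψ` (`ψ(−t,x) = σψ(t,x)`), apex time `t₁ ≥ 0`; put (all in `[0, ∞]`)
`OUT(t) = ½∫_{x>xp}[(ψ_t−ψ_x)²+Vψ²] + ½∫_{x<xp}[(ψ_t+ψ_x)²+Vψ²]`, `IN = E − OUT`, `K`/`P` = kinetic/potential influx through the null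
edges `x = xp ± (t−t₁)`, `B = ½∬_{t>t₁,|x−xp|>t−t₁}|V′|ψ²`, `C = ½∫₀^{t₁}∫|V′|ψ²`, `Q_V = ∫₀^{t₁}Vψ²(·,xp)`, `Q₊ = ∫₀^{t₁}(ψ_t²+ψ_x²)(·,xp)`,
`caught(t₁) = channelEnergy V xp (−t₁) ψ atTop`.  The landed identities give `E = caught + K + P` (`stub_lostFlux`), `K + B ≤ IN(t₁)`
(`stub_coneInflux`), `OUT(t₁) + Q_V = OUT(0) + Q₊ + C` (`stub_outVirial`), and here `OUT + IN = E` (`out_add_in`) and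
`OUT(0) = IN(0)` for parity-pure data (`out_eq_in_of_parity`), whence
`caught(t₁) + P(t₁) + Q_V ≥ E/2 + Q₊ + C + B`   (★).

Main results: `caught_of_trappedShare` ((★) + a trapped-share bound `P + Q_V ≤ (½ − c)E + Q₊ + C + B` at some apex time
`t₁ ≤ T` for every finite-energy parity-`σ` off-shell solution of ONE mode ⇒ each radiates `≥ min(c,½)·E` ahead of the forward cone
of lag `ρ + T + X` about `0`), and `coreHigh_of_trappedShareHigh` / `coreMode_of_trappedShareMode` (the (★)-forms of the two
registered residues of the skeleton `Lines/Sketch.lean` v4 imply their caught-forms `stub_coreHigh σ` / `stub_coreMode σ`).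
-/

noncomputable section

set_option linter.dupNamespace false

namespace Summit.FinalStateConjecture.FinalStateConjecture.Theorems.WindowedShellChannelsSketch

open Literature.Geometry.Lorentzian Literature.Geometry.Lorentzian.ReggeWheeler
open Filter Set MeasureTheory
open scoped ENNReal Topology

variable {V : ℝ → ℝ} {ψ : ℝ → ℝ → ℝ}

/-- Continuity in `x` of the time-derivative slice of a `C²` function. -/
theorem continuous_dt (hψ : ContDiff ℝ 2 (Function.uncurry ψ)) (t : ℝ) :
    Continuous fun x => deriv (fun τ => ψ τ x) t := by
  have hp : Continuous fun x : ℝ => ((t, x) : ℝ × ℝ) := continuous_const.prodMk continuous_id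
  have h1 : Continuous fun x => fderiv ℝ (Function.uncurry ψ) (t, x) (1, 0) :=
    (WaveEnergy.continuous_fderiv_apply hψ (1, 0)).comp hp
  refine h1.congr fun x => ?_
  rw [WaveEnergy.deriv_slice_fst_eq hψ]

/-- Continuity in `x` of the space derivative slice of a `C²` function. -/
theorem continuous_dx (hψ : ContDiff ℝ 2 (Function.uncurry ψ)) (t : ℝ) :
    Continuous fun x => deriv (ψ t) x := by
  have hp : Continuous fun x : ℝ => ((t, x) : ℝ × ℝ) := continuous_const.prodMk continuous_id
  have h1 : Continuous fun x => fderiv ℝ (Function.uncurry ψ) (t, x) (0, 1) :=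
    (WaveEnergy.continuous_fderiv_apply hψ (0, 1)).comp hp
  refine h1.congr fun x => ?_
  rw [WaveEnergy.deriv_slice_snd_eq hψ]

/-- Continuity in `x` of a time slice of a `C²` function. -/
theorem continuous_slice (hψ : ContDiff ℝ 2 (Function.uncurry ψ)) (t : ℝ) :
    Continuous fun x => ψ t x :=
  hψ.continuous.comp (continuous_const.prodMk continuous_id)

/-- `OUT(t) + IN(t) = E(t)`: the two characteristic energies at time `t` add up to the total energy. -/
theorem out_add_in (hV : Continuous V) (hV0 : ∀ x, 0 ≤ V x) (hψ : ContDiff ℝ 2 (Function.uncurry ψ))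
    (xp t : ℝ) :
    ((∫⁻ x in Ioi xp, ENNReal.ofReal
        (2⁻¹ * ((deriv (fun τ => ψ τ x) t - deriv (ψ t) x) ^ 2 + V x * ψ t x ^ 2)))
      + (∫⁻ x in Iio xp, ENNReal.ofReal
        (2⁻¹ * ((deriv (fun τ => ψ τ x) t + deriv (ψ t) x) ^ 2 + V x * ψ t x ^ 2))))
    + ((∫⁻ x in Ioi xp, ENNReal.ofReal
        (2⁻¹ * ((deriv (fun τ => ψ τ x) t + deriv (ψ t) x) ^ 2 + V x * ψ t x ^ 2)))
      + (∫⁻ x in Iio xp, ENNReal.ofReal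
        (2⁻¹ * ((deriv (fun τ => ψ τ x) t - deriv (ψ t) x) ^ 2 + V x * ψ t x ^ 2))))
    = totalEnergy V ψ t := by
  have hac : Continuous fun x => deriv (fun τ => ψ τ x) t := continuous_dt hψ t
  have hbc : Continuous fun x => deriv (ψ t) x := continuous_dx hψ t
  have hψc : Continuous fun x => ψ t x := continuous_slice hψ t
  have hm : Continuous fun x =>
      2⁻¹ * ((deriv (fun τ => ψ τ x) t - deriv (ψ t) x) ^ 2 + V x * ψ t x ^ 2) :=
    continuous_const.mul (((hac.sub hbc).pow 2).add (hV.mul (hψc.pow 2)))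
  have hp : Continuous fun x =>
      2⁻¹ * ((deriv (fun τ => ψ τ x) t + deriv (ψ t) x) ^ 2 + V x * ψ t x ^ 2) :=
    continuous_const.mul (((hac.add hbc).pow 2).add (hV.mul (hψc.pow 2)))
  have hmm : Measurable fun x => ENNReal.ofReal
      (2⁻¹ * ((deriv (fun τ => ψ τ x) t - deriv (ψ t) x) ^ 2 + V x * ψ t x ^ 2)) :=
    ENNReal.measurable_ofReal.comp hm.measurable
  have hpm : Measurable fun x => ENNReal.ofReal
      (2⁻¹ * ((deriv (fun τ => ψ τ x) t + deriv (ψ t) x) ^ 2 + V x * ψ t x ^ 2)) :=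
    ENNReal.measurable_ofReal.comp hp.measurable
  -- pointwise: the two halves of the characteristic split add up to the energy density
  have hpt : ∀ x, ENNReal.ofReal
        (2⁻¹ * ((deriv (fun τ => ψ τ x) t - deriv (ψ t) x) ^ 2 + V x * ψ t x ^ 2))
      + ENNReal.ofReal
        (2⁻¹ * ((deriv (fun τ => ψ τ x) t + deriv (ψ t) x) ^ 2 + V x * ψ t x ^ 2))
      = ENNReal.ofReal (energyDensity V ψ t x) := by
    intro x
    have hVx := hV0 x
    rw [← ENNReal.ofReal_add (by positivity) (by positivity)]
    congr 1
    simp only [energyDensity]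
    ring
  have hR : (∫⁻ x in Ioi xp, ENNReal.ofReal
        (2⁻¹ * ((deriv (fun τ => ψ τ x) t - deriv (ψ t) x) ^ 2 + V x * ψ t x ^ 2)))
      + (∫⁻ x in Ioi xp, ENNReal.ofReal
        (2⁻¹ * ((deriv (fun τ => ψ τ x) t + deriv (ψ t) x) ^ 2 + V x * ψ t x ^ 2)))
      = ∫⁻ x in Ioi xp, ENNReal.ofReal (energyDensity V ψ t x) := by
    rw [← lintegral_add_left hmm]
    exact lintegral_congr fun x => hpt x
  have hL : (∫⁻ x in Iio xp, ENNReal.ofReal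
        (2⁻¹ * ((deriv (fun τ => ψ τ x) t + deriv (ψ t) x) ^ 2 + V x * ψ t x ^ 2)))
      + (∫⁻ x in Iio xp, ENNReal.ofReal
        (2⁻¹ * ((deriv (fun τ => ψ τ x) t - deriv (ψ t) x) ^ 2 + V x * ψ t x ^ 2)))
      = ∫⁻ x in Iio xp, ENNReal.ofReal (energyDensity V ψ t x) := by
    rw [← lintegral_add_left hpm]
    exact lintegral_congr fun x => by rw [add_comm]; exact hpt x
  -- regroup: (R⁻ + L⁺) + (R⁺ + L⁻) = (R⁻ + R⁺) + (L⁺ + L⁻)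
  have hregroup : ∀ p q r s : ℝ≥0∞, (p + q) + (r + s) = (p + r) + (q + s) := fun p q r s => by
    abel
  rw [hregroup, hR, hL]
  -- `Ioi xp ∪ Iio xp` is all of `ℝ` up to the null set `{xp}`
  unfold totalEnergy
  rw [← lintegral_union measurableSet_Iio (Set.disjoint_iff.2 fun x ⟨h1, h2⟩ =>
    (lt_irrefl x (lt_trans (mem_Iio.1 h2) (mem_Ioi.1 h1))).elim)]
  have hset : Ioi xp ∪ Iio xp = ({xp}ᶜ : Set ℝ) := by
    ext x
    simp only [mem_union, mem_Ioi, mem_Iio, mem_compl_iff, mem_singleton_iff]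
    constructor
    · rintro (h | h)
      · exact ne_of_gt h
      · exact ne_of_lt h
    · intro h
      rcases lt_or_gt_of_ne h with h | h
      · exact Or.inr h
      · exact Or.inl h
  rw [hset, setLIntegral_compl (measurableSet_singleton xp) (by simp),
    setLIntegral_measure_zero _ _ (measure_singleton xp), tsub_zero]

/-- Parity-pure data (`ψ(−t,x) = σψ(t,x)`) have `ψ_t(0,x)·ψ_x(0,x) = 0` (σ = 1 kills `ψ_t(0,·)`, σ ≠ 1 kills
`ψ(0,·)` and hence `ψ_x(0,·)`). -/
theorem dt_mul_dx_zero {σ : ℝ} (hpar : ∀ t x, ψ (-t) x = σ * ψ t x) (x : ℝ) :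
    deriv (fun τ => ψ τ x) 0 * deriv (ψ 0) x = 0 := by
  by_cases hσ : σ = 1
  · have h1 : deriv (fun τ => ψ (-τ) x) 0 = -deriv (fun τ => ψ τ x) 0 := by
      rw [deriv_comp_neg (fun τ => ψ τ x) 0, neg_zero]
    have h2 : (fun τ => ψ (-τ) x) = fun τ => ψ τ x :=
      funext fun τ => by rw [hpar, hσ, one_mul]
    rw [h2] at h1
    have : deriv (fun τ => ψ τ x) 0 = 0 := by linarith
    rw [this, zero_mul]
  · have h0 : ∀ y, ψ 0 y = 0 := fun y => by
      have h := hpar 0 y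
      rw [neg_zero] at h
      have h' : (1 - σ) * ψ 0 y = 0 := by linarith
      rcases mul_eq_zero.1 h' with h'' | h''
      · exact absurd (by linarith : σ = 1) hσ
      · exact h''
    have : deriv (ψ 0) x = 0 := by
      have hf : ψ 0 = fun _ => (0 : ℝ) := funext h0
      rw [hf, deriv_const]
    rw [this, mul_zero]

/-- Hence `OUT(0) = IN(0)` for parity-pure data: the characteristic split is balanced at `t = 0`. -/
theorem out_eq_in_of_parity {σ : ℝ} (hpar : ∀ t x, ψ (-t) x = σ * ψ t x) (xp : ℝ) :
    (∫⁻ x in Ioi xp, ENNReal.ofReal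
        (2⁻¹ * ((deriv (fun τ => ψ τ x) 0 - deriv (ψ 0) x) ^ 2 + V x * ψ 0 x ^ 2)))
      + (∫⁻ x in Iio xp, ENNReal.ofReal
        (2⁻¹ * ((deriv (fun τ => ψ τ x) 0 + deriv (ψ 0) x) ^ 2 + V x * ψ 0 x ^ 2)))
    = (∫⁻ x in Ioi xp, ENNReal.ofReal
        (2⁻¹ * ((deriv (fun τ => ψ τ x) 0 + deriv (ψ 0) x) ^ 2 + V x * ψ 0 x ^ 2)))
      + (∫⁻ x in Iio xp, ENNReal.ofReal
        (2⁻¹ * ((deriv (fun τ => ψ τ x) 0 - deriv (ψ 0) x) ^ 2 + V x * ψ 0 x ^ 2))) := by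
  have hpt : ∀ x, (deriv (fun τ => ψ τ x) 0 - deriv (ψ 0) x) ^ 2
      = (deriv (fun τ => ψ τ x) 0 + deriv (ψ 0) x) ^ 2 := fun x => by
    have h := dt_mul_dx_zero hpar x
    nlinarith [h]
  congr 1
  · exact lintegral_congr fun x => by rw [hpt x]
  · exact lintegral_congr fun x => by rw [hpt x]

/-- TOOL (proved; the content of line `Sketch`): **(★) + trapped share ⇒ caught**, one mode at a time.  For the potential
`V = V_{s,ℓ}` (unit mass, centred line) with the shape data of `stub_peakShape` at the peak `xp`, if every finite-energy parity-`σ`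
off-shell solution admits an apex time `t₁ ≤ T` with `P(t₁) + Q_V(t₁) ≤ (½ − c)E + Q₊(t₁) + C(t₁) + B(t₁)`, then every such solution
radiates at least `min(c, ½)·E` ahead of the forward cone of lag `h = ρ + T + X` about `0`.  Proof: the bookkeeping (★)
`caught(t₁) + P + Q_V ≥ E/2 + Q₊ + C + B` from `stub_outVirial` (virial law), `stub_coneInflux` (influx law), `stub_lostFlux`
(flux formula), `OUT + IN = E` and `OUT(0) = IN(0)` (parity), in `ℝ` after finiteness of every player, then the cone with apex
`(t₁, xp)` sits inside the lagged cone about `0`. -/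
theorem caught_of_trappedShare {σ ρ T c K X : ℝ} (hc : 0 < c) {s ℓ : ℕ} (hsℓ : s ≤ ℓ)
    (hHas : ∀ x, HasDerivAt (linePotential 1 s ℓ (tortoiseRadius one_pos 0))
      (deriv (linePotential 1 s ℓ (tortoiseRadius one_pos 0)) x) x)
    (hV'c : Continuous (deriv (linePotential 1 s ℓ (tortoiseRadius one_pos 0))))
    (hKV : ∀ x, |deriv (linePotential 1 s ℓ (tortoiseRadius one_pos 0)) x|
      ≤ K * linePotential 1 s ℓ (tortoiseRadius one_pos 0) x)
    {xp : ℝ} (hxp : |xp| ≤ X) (hmono : ∀ x, (x - xp) * deriv (linePotential 1 s ℓ (tortoiseRadius one_pos 0)) x ≤ 0)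
    (hTS : ∀ ψ : ℝ → ℝ → ℝ, IsRWSolution 1 s ℓ (tortoiseRadius one_pos 0) ψ → (∀ t x, ψ (-t) x = σ * ψ t x) →
        CauchyDataSupportedOn ψ {x : ℝ | ρ < |x|} →
        totalEnergy (linePotential 1 s ℓ (tortoiseRadius one_pos 0)) ψ 0 ≠ ⊤ →
        ∃ t₁ : ℝ, 0 ≤ t₁ ∧ t₁ ≤ T ∧
          (∫⁻ t in Ioi t₁, ENNReal.ofReal
              (linePotential 1 s ℓ (tortoiseRadius one_pos 0) (xp + (t - t₁)) * ψ t (xp + (t - t₁)) ^ 2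
                + linePotential 1 s ℓ (tortoiseRadius one_pos 0) (xp - (t - t₁)) * ψ t (xp - (t - t₁)) ^ 2))
            + ENNReal.ofReal (∫ τ in (0:ℝ)..t₁,
                linePotential 1 s ℓ (tortoiseRadius one_pos 0) xp * ψ τ xp ^ 2)
          ≤ ENNReal.ofReal ((2⁻¹ - c)
                * (totalEnergy (linePotential 1 s ℓ (tortoiseRadius one_pos 0)) ψ 0).toReal)
            + ENNReal.ofReal (∫ τ in (0:ℝ)..t₁, (deriv (fun τ' => ψ τ' xp) τ ^ 2 + deriv (ψ τ) xp ^ 2))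
            + (∫⁻ z in Ioo (0:ℝ) t₁ ×ˢ (univ : Set ℝ), ENNReal.ofReal
                (2⁻¹ * (|deriv (linePotential 1 s ℓ (tortoiseRadius one_pos 0)) z.2| * ψ z.1 z.2 ^ 2)))
            + (∫⁻ z in {z : ℝ × ℝ | t₁ < z.1 ∧ z.1 - t₁ < |z.2 - xp|}, ENNReal.ofReal
                (2⁻¹ * (|deriv (linePotential 1 s ℓ (tortoiseRadius one_pos 0)) z.2| * ψ z.1 z.2 ^ 2)))) :
    ∀ ψ : ℝ → ℝ → ℝ,
        IsRWSolution 1 s ℓ (tortoiseRadius one_pos 0) ψ → (∀ t x, ψ (-t) x = σ * ψ t x) →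
        CauchyDataSupportedOn ψ {x : ℝ | ρ < |x|} →
        totalEnergy (linePotential 1 s ℓ (tortoiseRadius one_pos 0)) ψ 0 ≠ ⊤ →
          ENNReal.ofReal (min c 2⁻¹) * totalEnergy (linePotential 1 s ℓ (tortoiseRadius one_pos 0)) ψ 0 ≤
            channelEnergy (linePotential 1 s ℓ (tortoiseRadius one_pos 0)) 0 (ρ - (ρ + T + X)) ψ atTop := by
  intro ψ hψ hpar hsupp hE
  obtain ⟨t₁, ht₁0, ht₁T, hTS'⟩ := hTS ψ hψ hpar hsupp hE
  have hr := isTortoiseRadius_tortoiseRadius one_pos 0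
  -- notation-free abbreviations
  generalize hVdef : linePotential 1 s ℓ (tortoiseRadius one_pos 0) = V at *
  have hVd : Differentiable ℝ V := hVdef ▸ RW.differentiable_linePotential hr s ℓ
  have hV0 : ∀ x, 0 ≤ V x := fun x => hVdef ▸ (RW.linePotential_pos hr hsℓ x).le
  have hψ' : IsSolution V ψ := hVdef ▸ hψ
  -- the three identities and the two structural facts
  have hVir := stub_outVirial V (deriv V) K xp hHas hV'c hV0 hKV hmono ψ hψ' hE t₁ ht₁0
  have hInf := stub_coneInflux V (deriv V) K xp hHas hV'c hV0 hKV hmono ψ hψ' hE t₁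
  have hFlux := stub_lostFlux V xp hVd hV0 ψ hψ' hE t₁ ht₁0
  have hsum₁ := out_add_in (V := V) hVd.continuous hV0 hψ'.1 xp t₁
  have hsum₀ := out_add_in (V := V) hVd.continuous hV0 hψ'.1 xp 0
  have hpar₀ := out_eq_in_of_parity (V := V) (ψ := ψ) hpar xp
  have hcons : totalEnergy V ψ t₁ = totalEnergy V ψ 0 :=
    RW.totalEnergy_eq_totalEnergy hVd hV0 hψ' t₁ 0
  rw [hcons] at hsum₁
  -- name the players (closed terms, so `set` abstracts them in every hypothesis)
  set E := totalEnergy V ψ 0 with hEdef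
  set caught := channelEnergy V xp (-t₁) ψ atTop with hcaught
  set Om₁ := ∫⁻ x in Ioi xp, ENNReal.ofReal
      (2⁻¹ * ((deriv (fun τ => ψ τ x) t₁ - deriv (ψ t₁) x) ^ 2 + V x * ψ t₁ x ^ 2)) with hOm₁
  set Lp₁ := ∫⁻ x in Iio xp, ENNReal.ofReal
      (2⁻¹ * ((deriv (fun τ => ψ τ x) t₁ + deriv (ψ t₁) x) ^ 2 + V x * ψ t₁ x ^ 2)) with hLp₁
  set Op₁ := ∫⁻ x in Ioi xp, ENNReal.ofReal
      (2⁻¹ * ((deriv (fun τ => ψ τ x) t₁ + deriv (ψ t₁) x) ^ 2 + V x * ψ t₁ x ^ 2)) with hOp₁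
  set Lm₁ := ∫⁻ x in Iio xp, ENNReal.ofReal
      (2⁻¹ * ((deriv (fun τ => ψ τ x) t₁ - deriv (ψ t₁) x) ^ 2 + V x * ψ t₁ x ^ 2)) with hLm₁
  set Om₀ := ∫⁻ x in Ioi xp, ENNReal.ofReal
      (2⁻¹ * ((deriv (fun τ => ψ τ x) 0 - deriv (ψ 0) x) ^ 2 + V x * ψ 0 x ^ 2)) with hOm₀
  set Lp₀ := ∫⁻ x in Iio xp, ENNReal.ofReal
      (2⁻¹ * ((deriv (fun τ => ψ τ x) 0 + deriv (ψ 0) x) ^ 2 + V x * ψ 0 x ^ 2)) with hLp₀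
  set Op₀ := ∫⁻ x in Ioi xp, ENNReal.ofReal
      (2⁻¹ * ((deriv (fun τ => ψ τ x) 0 + deriv (ψ 0) x) ^ 2 + V x * ψ 0 x ^ 2)) with hOp₀
  set Lm₀ := ∫⁻ x in Iio xp, ENNReal.ofReal
      (2⁻¹ * ((deriv (fun τ => ψ τ x) 0 - deriv (ψ 0) x) ^ 2 + V x * ψ 0 x ^ 2)) with hLm₀
  set Kk := ∫⁻ t in Ioi t₁, ENNReal.ofReal
      ((deriv (fun τ => ψ τ (xp + (t - t₁))) t + deriv (ψ t) (xp + (t - t₁))) ^ 2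
        + (deriv (fun τ => ψ τ (xp - (t - t₁))) t - deriv (ψ t) (xp - (t - t₁))) ^ 2) with hKk
  set Pp := ∫⁻ t in Ioi t₁, ENNReal.ofReal
      (V (xp + (t - t₁)) * ψ t (xp + (t - t₁)) ^ 2 + V (xp - (t - t₁)) * ψ t (xp - (t - t₁)) ^ 2)
    with hPp
  set Bb := ∫⁻ z in {z : ℝ × ℝ | t₁ < z.1 ∧ z.1 - t₁ < |z.2 - xp|},
      ENNReal.ofReal (2⁻¹ * (|deriv V z.2| * ψ z.1 z.2 ^ 2)) with hBb
  set Cc := ∫⁻ z in Ioo (0:ℝ) t₁ ×ˢ (univ : Set ℝ),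
      ENNReal.ofReal (2⁻¹ * (|deriv V z.2| * ψ z.1 z.2 ^ 2)) with hCc
  set QV := ENNReal.ofReal (∫ τ in (0:ℝ)..t₁, V xp * ψ τ xp ^ 2) with hQV
  set Qk := ENNReal.ofReal (∫ τ in (0:ℝ)..t₁,
      (deriv (fun τ' => ψ τ' xp) τ ^ 2 + deriv (ψ τ) xp ^ 2)) with hQk
  -- the constant actually used
  set c' := min c 2⁻¹ with hc'
  have hc'c : c' ≤ c := min_le_left _ _
  have hc'h : c' ≤ 2⁻¹ := min_le_right _ _
  have hc'0 : 0 ≤ c' := (lt_min hc (by norm_num)).le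
  have hTS'' : Pp + QV ≤ ENNReal.ofReal ((2⁻¹ - c') * E.toReal) + Qk + Cc + Bb := by
    refine hTS'.trans ?_
    have hmul : (2⁻¹ - c) * E.toReal ≤ (2⁻¹ - c') * E.toReal :=
      mul_le_mul_of_nonneg_right (by linarith) ENNReal.toReal_nonneg
    exact add_le_add (add_le_add (add_le_add (ENNReal.ofReal_le_ofReal hmul) le_rfl) le_rfl) le_rfl
  -- finiteness of every player
  have hEt : E ≠ ⊤ := hE
  have hKt : Kk ≠ ⊤ := ne_top_of_le_ne_top hEt (by rw [← hFlux]; exact le_add_left le_rfl |>.trans (le_add_right le_rfl))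
  have hPt : Pp ≠ ⊤ := ne_top_of_le_ne_top hEt (by rw [← hFlux]; exact le_add_left le_rfl)
  have hcat : caught ≠ ⊤ := ne_top_of_le_ne_top hEt (by rw [← hFlux, add_assoc]; exact le_add_right le_rfl)
  have hO₁t : Om₁ + Lp₁ ≠ ⊤ := ne_top_of_le_ne_top hEt (by rw [← hsum₁]; exact le_add_right le_rfl)
  have hI₁t : Op₁ + Lm₁ ≠ ⊤ := ne_top_of_le_ne_top hEt (by rw [← hsum₁]; exact le_add_left le_rfl)
  have hO₀t : Om₀ + Lp₀ ≠ ⊤ := ne_top_of_le_ne_top hEt (by rw [← hsum₀]; exact le_add_right le_rfl)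
  have hI₀t : Op₀ + Lm₀ ≠ ⊤ := ne_top_of_le_ne_top hEt (by rw [← hsum₀]; exact le_add_left le_rfl)
  have hBt : Bb ≠ ⊤ := ne_top_of_le_ne_top hI₁t (le_trans (le_add_left le_rfl) hInf)
  have hQVt : QV ≠ ⊤ := ENNReal.ofReal_ne_top
  have hQkt : Qk ≠ ⊤ := ENNReal.ofReal_ne_top
  have hCt : Cc ≠ ⊤ := by
    refine ne_top_of_le_ne_top (ENNReal.add_ne_top.2 ⟨hO₁t, hQVt⟩) ?_
    rw [hVir]
    exact le_add_left le_rfl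
  have hRt : ENNReal.ofReal ((2⁻¹ - c') * E.toReal) ≠ ⊤ := ENNReal.ofReal_ne_top
  -- pass to real numbers
  have eVir := congrArg ENNReal.toReal hVir
  rw [ENNReal.toReal_add hO₁t hQVt, ENNReal.toReal_add (ENNReal.add_ne_top.2 ⟨hO₀t, hQkt⟩) hCt,
    ENNReal.toReal_add hO₀t hQkt] at eVir
  have eInf := ENNReal.toReal_mono hI₁t hInf
  rw [ENNReal.toReal_add hKt hBt] at eInf
  have eFlux := congrArg ENNReal.toReal hFlux
  rw [ENNReal.toReal_add (ENNReal.add_ne_top.2 ⟨hcat, hKt⟩) hPt, ENNReal.toReal_add hcat hKt] at eFlux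
  have eSum₁ := congrArg ENNReal.toReal hsum₁
  rw [ENNReal.toReal_add hO₁t hI₁t] at eSum₁
  have eSum₀ := congrArg ENNReal.toReal hsum₀
  rw [ENNReal.toReal_add hO₀t hI₀t] at eSum₀
  have ePar := congrArg ENNReal.toReal hpar₀
  have eTS := ENNReal.toReal_mono
    (ENNReal.add_ne_top.2 ⟨ENNReal.add_ne_top.2 ⟨ENNReal.add_ne_top.2 ⟨hRt, hQkt⟩, hCt⟩, hBt⟩) hTS''
  rw [ENNReal.toReal_add hPt hQVt, ENNReal.toReal_add (ENNReal.add_ne_top.2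
      ⟨ENNReal.add_ne_top.2 ⟨hRt, hQkt⟩, hCt⟩) hBt,
    ENNReal.toReal_add (ENNReal.add_ne_top.2 ⟨hRt, hQkt⟩) hCt, ENNReal.toReal_add hRt hQkt,
    ENNReal.toReal_ofReal (mul_nonneg (by linarith) ENNReal.toReal_nonneg)] at eTS
  -- (★) + trapped share ⇒ `c'·E ≤ caught`, in `ℝ`
  have key : c' * E.toReal ≤ caught.toReal := by nlinarith
  -- back to `ℝ≥0∞`
  have keyE : ENNReal.ofReal c' * E ≤ caught := by
    rw [← ENNReal.ofReal_toReal hEt, ← ENNReal.ofReal_mul hc'0, ← ENNReal.ofReal_toReal hcat]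
    exact ENNReal.ofReal_le_ofReal key
  refine keyE.trans ?_
  -- the cone with apex `(t₁, xp)` sits inside the lagged cone of W (`h = ρ + T + X ≥ ρ + t₁ + |xp|`)
  refine Filter.liminf_le_liminf (Eventually.of_forall fun t => ?_)
  unfold exteriorEnergy
  refine lintegral_mono_set fun x hx => ?_
  simp only [mem_setOf_eq, sub_zero] at hx ⊢
  have h1 : |x - xp| ≤ |x| + |xp| := abs_sub x xp
  linarith


/-- TOOL (proved): the (★)-form of the semiclassical core implies its caught-form `stub_coreHigh σ` (lag `ρ + T + X`, constant
`min(c, ½)`), by `caught_of_trappedShare` and `stub_peakShape`. -/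
theorem coreHigh_of_trappedShareHigh (σ : ℝ)
    (H : ∀ ρ : ℝ, 0 < ρ → ∃ ℓ₀ : ℕ, ∃ T : ℝ, 0 ≤ T ∧ ∃ c : ℝ, 0 < c ∧
    ∀ (s ℓ : ℕ), s ≤ 2 → s ≤ ℓ → ℓ₀ ≤ ℓ → ∀ xp : ℝ,
      (∀ x, (x - xp) * deriv (linePotential 1 s ℓ (tortoiseRadius one_pos 0)) x ≤ 0) →
      ∀ ψ : ℝ → ℝ → ℝ, IsRWSolution 1 s ℓ (tortoiseRadius one_pos 0) ψ → (∀ t x, ψ (-t) x = σ * ψ t x) →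
        CauchyDataSupportedOn ψ {x : ℝ | ρ < |x|} →
        totalEnergy (linePotential 1 s ℓ (tortoiseRadius one_pos 0)) ψ 0 ≠ ⊤ →
        ∃ t₁ : ℝ, 0 ≤ t₁ ∧ t₁ ≤ T ∧
          (∫⁻ t in Ioi t₁, ENNReal.ofReal
              (linePotential 1 s ℓ (tortoiseRadius one_pos 0) (xp + (t - t₁)) * ψ t (xp + (t - t₁)) ^ 2
                + linePotential 1 s ℓ (tortoiseRadius one_pos 0) (xp - (t - t₁)) * ψ t (xp - (t - t₁)) ^ 2))
            + ENNReal.ofReal (∫ τ in (0:ℝ)..t₁,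
                linePotential 1 s ℓ (tortoiseRadius one_pos 0) xp * ψ τ xp ^ 2)
          ≤ ENNReal.ofReal ((2⁻¹ - c)
                * (totalEnergy (linePotential 1 s ℓ (tortoiseRadius one_pos 0)) ψ 0).toReal)
            + ENNReal.ofReal (∫ τ in (0:ℝ)..t₁, (deriv (fun τ' => ψ τ' xp) τ ^ 2 + deriv (ψ τ) xp ^ 2))
            + (∫⁻ z in Ioo (0:ℝ) t₁ ×ˢ (univ : Set ℝ), ENNReal.ofReal
                (2⁻¹ * (|deriv (linePotential 1 s ℓ (tortoiseRadius one_pos 0)) z.2| * ψ z.1 z.2 ^ 2)))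
            + (∫⁻ z in {z : ℝ × ℝ | t₁ < z.1 ∧ z.1 - t₁ < |z.2 - xp|}, ENNReal.ofReal
                (2⁻¹ * (|deriv (linePotential 1 s ℓ (tortoiseRadius one_pos 0)) z.2| * ψ z.1 z.2 ^ 2)))) :
    ∀ ρ : ℝ, 0 < ρ → ∃ ℓ₀ : ℕ, ∃ h : ℝ, 0 ≤ h ∧ ∃ c : ℝ, 0 < c ∧
    ∀ (s ℓ : ℕ), s ≤ 2 → s ≤ ℓ → ℓ₀ ≤ ℓ → ∀ ψ : ℝ → ℝ → ℝ,
        IsRWSolution 1 s ℓ (tortoiseRadius one_pos 0) ψ → (∀ t x, ψ (-t) x = σ * ψ t x) →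
        CauchyDataSupportedOn ψ {x : ℝ | ρ < |x|} →
        totalEnergy (linePotential 1 s ℓ (tortoiseRadius one_pos 0)) ψ 0 ≠ ⊤ →
          ENNReal.ofReal c * totalEnergy (linePotential 1 s ℓ (tortoiseRadius one_pos 0)) ψ 0 ≤
            channelEnergy (linePotential 1 s ℓ (tortoiseRadius one_pos 0)) 0 (ρ - h) ψ atTop := by
  intro ρ hρ
  obtain ⟨K, -, X, hX0, hshape⟩ := stub_peakShape
  obtain ⟨ℓ₀, T, hT0, c, hc, hTS⟩ := H ρ hρ
  refine ⟨ℓ₀, ρ + T + X, by positivity, min c 2⁻¹, lt_min hc (by norm_num), fun s ℓ hs hsℓ hℓ => ?_⟩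
  obtain ⟨hHas, hV'c, hKV, xp, hxp, hmono⟩ := hshape s ℓ hs hsℓ
  exact caught_of_trappedShare hc hsℓ hHas hV'c hKV hxp hmono (hTS s ℓ hs hsℓ hℓ xp hmono)

/-- TOOL (proved): the (★)-form of the per-mode core implies its caught-form `stub_coreMode σ`. -/
theorem coreMode_of_trappedShareMode (σ : ℝ)
    (H : ∀ ρ : ℝ, 0 < ρ → ∀ (s ℓ : ℕ), s ≤ 2 → s ≤ ℓ →
    ∃ T : ℝ, 0 ≤ T ∧ ∃ c : ℝ, 0 < c ∧ ∀ xp : ℝ,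
      (∀ x, (x - xp) * deriv (linePotential 1 s ℓ (tortoiseRadius one_pos 0)) x ≤ 0) →
      ∀ ψ : ℝ → ℝ → ℝ, IsRWSolution 1 s ℓ (tortoiseRadius one_pos 0) ψ → (∀ t x, ψ (-t) x = σ * ψ t x) →
        CauchyDataSupportedOn ψ {x : ℝ | ρ < |x|} →
        totalEnergy (linePotential 1 s ℓ (tortoiseRadius one_pos 0)) ψ 0 ≠ ⊤ →
        ∃ t₁ : ℝ, 0 ≤ t₁ ∧ t₁ ≤ T ∧
          (∫⁻ t in Ioi t₁, ENNReal.ofReal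
              (linePotential 1 s ℓ (tortoiseRadius one_pos 0) (xp + (t - t₁)) * ψ t (xp + (t - t₁)) ^ 2
                + linePotential 1 s ℓ (tortoiseRadius one_pos 0) (xp - (t - t₁)) * ψ t (xp - (t - t₁)) ^ 2))
            + ENNReal.ofReal (∫ τ in (0:ℝ)..t₁,
                linePotential 1 s ℓ (tortoiseRadius one_pos 0) xp * ψ τ xp ^ 2)
          ≤ ENNReal.ofReal ((2⁻¹ - c)
                * (totalEnergy (linePotential 1 s ℓ (tortoiseRadius one_pos 0)) ψ 0).toReal)
            + ENNReal.ofReal (∫ τ in (0:ℝ)..t₁, (deriv (fun τ' => ψ τ' xp) τ ^ 2 + deriv (ψ τ) xp ^ 2))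
            + (∫⁻ z in Ioo (0:ℝ) t₁ ×ˢ (univ : Set ℝ), ENNReal.ofReal
                (2⁻¹ * (|deriv (linePotential 1 s ℓ (tortoiseRadius one_pos 0)) z.2| * ψ z.1 z.2 ^ 2)))
            + (∫⁻ z in {z : ℝ × ℝ | t₁ < z.1 ∧ z.1 - t₁ < |z.2 - xp|}, ENNReal.ofReal
                (2⁻¹ * (|deriv (linePotential 1 s ℓ (tortoiseRadius one_pos 0)) z.2| * ψ z.1 z.2 ^ 2)))) :
    ∀ ρ : ℝ, 0 < ρ → ∀ (s ℓ : ℕ), s ≤ 2 → s ≤ ℓ → ∃ h : ℝ, 0 ≤ h ∧ ∃ c : ℝ, 0 < c ∧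
    ∀ ψ : ℝ → ℝ → ℝ,
        IsRWSolution 1 s ℓ (tortoiseRadius one_pos 0) ψ → (∀ t x, ψ (-t) x = σ * ψ t x) →
        CauchyDataSupportedOn ψ {x : ℝ | ρ < |x|} →
        totalEnergy (linePotential 1 s ℓ (tortoiseRadius one_pos 0)) ψ 0 ≠ ⊤ →
          ENNReal.ofReal c * totalEnergy (linePotential 1 s ℓ (tortoiseRadius one_pos 0)) ψ 0 ≤
            channelEnergy (linePotential 1 s ℓ (tortoiseRadius one_pos 0)) 0 (ρ - h) ψ atTop := by
  intro ρ hρ s ℓ hs hsℓ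
  obtain ⟨K, -, X, hX0, hshape⟩ := stub_peakShape
  obtain ⟨T, hT0, c, hc, hTS⟩ := H ρ hρ s ℓ hs hsℓ
  obtain ⟨hHas, hV'c, hKV, xp, hxp, hmono⟩ := hshape s ℓ hs hsℓ
  exact ⟨ρ + T + X, by positivity, min c 2⁻¹, lt_min hc (by norm_num),
    caught_of_trappedShare hc hsℓ hHas hV'c hKV hxp hmono (hTS xp hmono)⟩

end Summit.FinalStateConjecture.FinalStateConjecture.Theorems.WindowedShellChannelsSketch

end
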